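import Mathlib
import HarnessLib
import Summits.NavierStokesRegularity.NavierStokesRegularity.Theorems.HalfSpaceWindowDoorCirculationCarryingRigidityConeLiouville
import Summits.NavierStokesRegularity.NavierStokesRegularity.Theorems.HalfSpaceWindowDoorCirculationCarryingRigidityRecordSweeping
import Summits.NavierStokesRegularity.NavierStokesRegularity.Theorems.HalfSpaceWindowDoorCirculationCarryingRigidityTransportRigidity
import Summits.NavierStokesRegularity.NavierStokesRegularity.Theorems.AxisTwistDoorAveragedConeLiouvilleCircleLimits

/-!
# Route `HalfSpaceWindowDoor`, crux `CirculationCarryingRigidity` (stmt-NavierStokesRegularity-25311) —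
# line `cone_sweep`, RECORD form, Step 4: `HemisphereLiouvilleE3` from the transport bound on RECORD circles of ONE far-past epoch

LEAD ns-hsw-p1 g9, `--supports stmt-NavierStokesRegularity-25311 --as helper`; card `Cruxes/…/Lines/cone_sweep.md`.  Sharpening of
`…TransportLiouville` (p687487) in two directions at once.

**Theorem (`inner_curl_e3_eq_zero_of_recordTransportBound`).**  Let `v` be a closed-hemisphere door-class profile (any `C`), `B, R₀ ≥ 0`,
`R₁ = 4B + R₀ + 1`, and `σ₀ < 0` an arbitrary epoch.  Suppose the one-sided transport bound
`−T(r,z,t) = ∮_{S(r,z)}(ω_r v₃ − v_r ω₃) dl ≤ (B/√(−t)) ∮_{S(r,z)} ω₃ dl` holds merely (i) at the times `t ≤ σ₀` of the far past and (ii) on the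
RECORD CIRCLES of those times: far circles `S(r,z)`, `r ≥ R₀√(−t)`, about the `e₃`-axis whose circulation `Γ(r,z,t)` exceeds the circulation of
every tube-boundary disc `D(R₁√(−s'), z')` at every earlier-or-equal time `s' ≤ t`.  Then `v` is POLOIDAL on the whole slab: `⟪curl v, e₃⟫ ≡ 0`.
Proof: the record sweeping lemma (`…RecordSweeping`) bounds `S₀ = sup_{t ≤ σ₀} Γ`; `S₀ = 0` ⇒ the far past is poloidal
(`inner_curl_e3_eq_zero_of_circ_nonpos`) ⇒ all times by analyticity in time (`inner_curl_e3_eq_zero_of_far_past`); `S₀ > 0` ⇒ near-maximal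
tube-boundary discs at times `s_n ≤ σ₀`, zooms about axis points, F3 limit, whose plane `{x₃ = 0}` at time `−1` is saturated ⇒ PLANE RIGIDITY
(`circ_eq_zero_of_saturated_plane`) ⇒ `S₀ = 0`, contradiction.
CENSUS READING (`enemy_record_fails`): a circulation-carrying closed-hemisphere door-class profile produces, in EVERY far-past epoch `(−∞, σ₀]` and for
all `B, R₀`, a RECORD far circle (more circulation than any tube-boundary disc so far) INTO which vertical-vorticity flux is being transported faster
than `(B/√(−t))∮ω₃ dl`: records outside the parabolic tube are set, again and again in the past, by fast inward transport.  By-name reduction of the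
open stub: `hemisphereLiouvilleE3_of_recordTransportBound`.
WHAT THIS IS NOT: not about NS regularity; HYPOTHETICAL profiles; `HemisphereLiouvilleE3` itself stays OPEN.  No item is closed by this file.
-/

noncomputable section

-- the summit and its single sub-problem share the name (CONVENTIONS §1), as in every Theorems file
set_option linter.dupNamespace false

namespace Summit.NavierStokesRegularity.NavierStokesRegularity.Theorems.HalfSpaceWindowDoorCirculationCarryingRigidityRecordLiouville

open MeasureTheory Set Function Filter Topology InnerProductSpace
open scoped RealInnerProductSpace InnerProductSpace
open Literature.Analysis Literature.Analysis.UnboundedOperators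
open Literature.Analysis.FluidPDE hiding eR
open Summit.NavierStokesRegularity.NavierStokesRegularity.Theses.HalfSpaceWindowDoor
open Summit.NavierStokesRegularity.NavierStokesRegularity.Theorems.HalfSpaceWindowDoorCirculationCarryingRigidityDefs
  (InDoorClass SignE3 e3 HemisphereLiouvilleE3)
open Summit.NavierStokesRegularity.NavierStokesRegularity.Theorems.AxisTwistDoorAveragedConeLiouvilleDefs
  (cylPt eT eR circ vortCirc circleTerm)
open Summit.NavierStokesRegularity.NavierStokesRegularity.Theorems.AveragedConeLiouville.CircMonotone (circ_zero circ_nonneg)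
open Summit.NavierStokesRegularity.NavierStokesRegularity.Theorems.AveragedConeLiouville.CircleLimits (tendsto_circ)
open Summit.NavierStokesRegularity.NavierStokesRegularity.Theorems
  (exists_tendsto_of_isTypeIAncientMild_seq isTypeIAncientMild_zoom zoom_apply)
open Summit.NavierStokesRegularity.NavierStokesRegularity.Theorems.HalfSpaceWindowDoorCirculationCarryingRigidityGaussExtremal
  (inDoorClass_of_isTypeIAncientMild)
open Summit.NavierStokesRegularity.NavierStokesRegularity.Theorems.HalfSpaceWindowDoorCirculationCarryingRigidityHorizontalVorticityFloor
  (tendsto_curl_of_tendsto_fderiv)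
open Summit.NavierStokesRegularity.NavierStokesRegularity.Theorems.PoloidalWindowDoorPoloidalWindowRigidityWindow
  (isTypeIAncientMild_of_class)
open Summit.NavierStokesRegularity.NavierStokesRegularity.Theorems.HalfSpaceWindowDoorCirculationCarryingRigidityCriticalStretchingAnalytic
  (inner_curl_e3_eq_zero_of_far_past)
open Summit.NavierStokesRegularity.NavierStokesRegularity.Theorems.HalfSpaceWindowDoorCirculationCarryingRigidityConeFluxSubsolution
  (signE3_atd contDiff_one_slice tube_bddAbove)
open Summit.NavierStokesRegularity.NavierStokesRegularity.Theorems.HalfSpaceWindowDoorCirculationCarryingRigidityRecordSweeping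
  (circ_le_sSup_of_record circ_le_const_of_record)
open Summit.NavierStokesRegularity.NavierStokesRegularity.Theorems.HalfSpaceWindowDoorCirculationCarryingRigidityTransportRigidity
  (circ_eq_zero_of_saturated_plane inner_curl_e3_eq_zero_of_circ_nonpos)
open Summit.NavierStokesRegularity.NavierStokesRegularity.Theorems.HalfSpaceWindowDoorCirculationCarryingRigidityConeLiouville
  (axisPt_add_smul_cylPt circ_zoom_axis)

variable {C : ℝ} {v : ℝ → EuclideanSpace ℝ (Fin 3) → EuclideanSpace ℝ (Fin 3)}

/-- **`HemisphereLiouvilleE3` FROM THE TRANSPORT BOUND ON RECORD CIRCLES OF ONE FAR-PAST EPOCH (all `C`, `B`, `R₀`, `σ₀`).** -/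
theorem inner_curl_e3_eq_zero_of_recordTransportBound (hv : InDoorClass C v) (hsign : SignE3 v) {B : ℝ} (hB : 0 ≤ B)
    {R₀ : ℝ} (hR₀ : 0 ≤ R₀) {σ₀ : ℝ} (hσ₀ : σ₀ < 0)
    (htr : ∀ t : ℝ, t ≤ σ₀ → ∀ r : ℝ, R₀ * Real.sqrt (-t) ≤ r → ∀ z : ℝ,
      (∀ s' : ℝ, s' ≤ t → ∀ z' : ℝ, circ v ((4 * B + R₀ + 1) * Real.sqrt (-s')) z' s' < circ v r z t) →
      -circleTerm v r z t ≤ B / Real.sqrt (-t) * vortCirc v r z t) :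
    ∀ s < 0, ∀ y, ⟪curl (v s) y, e3⟫ = 0 := by
  have hA : IsTypeIAncientMild C v := isTypeIAncientMild_of_class hv.1 hv.2.1 hv.2.2.1 hv.2.2.2
  set R₁ : ℝ := 4 * B + R₀ + 1 with hR₁
  have hC : 0 ≤ C := hA.nonneg
  have hR₁0 : 0 ≤ R₁ := by positivity
  -- the transport bound restricted to the times `≤ s` for `s ≤ σ₀`
  have htr' : ∀ s : ℝ, s ≤ σ₀ → ∀ t : ℝ, t ≤ s → ∀ r : ℝ, R₀ * Real.sqrt (-t) ≤ r → ∀ z : ℝ,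
      (∀ s' : ℝ, s' ≤ t → ∀ z' : ℝ, circ v ((4 * B + R₀ + 1) * Real.sqrt (-s')) z' s' < circ v r z t) →
      -circleTerm v r z t ≤ B / Real.sqrt (-t) * vortCirc v r z t :=
    fun s hs t ht r hr z hrec => htr t (ht.trans hs) r hr z hrec
  -- the circulations of the epoch and their supremum `S₀`
  set Tot : Set ℝ := {m | ∃ s : ℝ, s ≤ σ₀ ∧ ∃ r : ℝ, 0 ≤ r ∧ ∃ z : ℝ, m = circ v r z s} with hTot
  have hTotle : ∀ m ∈ Tot, m ≤ 2 * Real.pi * (R₁ * C) := by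
    rintro m ⟨s, hs, r, hr, z, rfl⟩
    exact circ_le_const_of_record hv hsign hB hR₀ (lt_of_le_of_lt hs hσ₀) (htr' s hs) hr z
  have hTotbdd : BddAbove Tot := ⟨_, hTotle⟩
  have hmem : ∀ s ≤ σ₀, ∀ r : ℝ, 0 ≤ r → ∀ z, circ v r z s ∈ Tot := fun s hs r hr z => ⟨s, hs, r, hr, z, rfl⟩
  have hTotne : Tot.Nonempty := ⟨_, hmem σ₀ le_rfl 0 le_rfl 0⟩
  set S₀ : ℝ := sSup Tot with hS₀
  have hleS : ∀ s ≤ σ₀, ∀ r : ℝ, 0 ≤ r → ∀ z, circ v r z s ≤ S₀ := fun s hs r hr z => le_csSup hTotbdd (hmem s hs r hr z)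
  have hm1 : (-1 : ℝ) < 0 := by norm_num
  rcases le_or_gt S₀ 0 with hS | hS
  · -- the far past is poloidal, hence (analyticity in time) the whole slab
    have hpast : ∀ τ < σ₀, ∀ y, ⟪curl (v τ) y, e3⟫ = 0 := fun τ hτ =>
      inner_curl_e3_eq_zero_of_circ_nonpos hv hsign (hτ.trans hσ₀) fun r hr z => (hleS τ hτ.le r hr z).trans hS
    exact inner_curl_e3_eq_zero_of_far_past hv.1 hv.2.1 hv.2.2.1 hσ₀ hpast
  -- `S₀ > 0`: near-maximal TUBE-BOUNDARY discs at some `(s_n, z_n)`, `s_n ≤ σ₀`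
  exfalso
  have hnear : ∀ n : ℕ, ∃ p : ℝ × ℝ, p.1 ≤ σ₀ ∧ S₀ - 1 / ((n : ℝ) + 1) < circ v (R₁ * Real.sqrt (-p.1)) p.2 p.1 := by
    intro n
    have hε : S₀ - 1 / ((n : ℝ) + 1) < S₀ := by
      have : (0 : ℝ) < 1 / ((n : ℝ) + 1) := by positivity
      linarith
    obtain ⟨m, ⟨s, hs, r, hr, z, rfl⟩, hm⟩ := exists_lt_of_lt_csSup hTotne hε
    have hs0 : s < 0 := lt_of_le_of_lt hs hσ₀
    -- the record sweeping lemma at `s₁ = s`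
    have hsw := circ_le_sSup_of_record hv hsign hB hR₀ hs0 (htr' s hs) le_rfl hr z
    obtain ⟨hTbdd, -⟩ := tube_bddAbove hv hR₁0 hs0
    have hTne : {m' : ℝ | ∃ s' : ℝ, s' ≤ s ∧ ∃ z' : ℝ, m' = circ v (R₁ * Real.sqrt (-s')) z' s'}.Nonempty :=
      ⟨_, s, le_rfl, 0, rfl⟩
    obtain ⟨m', ⟨s', hs', z', rfl⟩, hm'⟩ := exists_lt_of_lt_csSup hTne (lt_of_lt_of_le hm hsw)
    exact ⟨(s', z'), hs'.trans hs, hm'⟩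
  choose p hp1 hp2 using hnear
  set sn : ℕ → ℝ := fun n => (p n).1 with hsn
  set zn : ℕ → ℝ := fun n => (p n).2 with hzn
  have hsn0 : ∀ n, sn n < 0 := fun n => lt_of_le_of_lt (hp1 n) hσ₀
  set lam : ℕ → ℝ := fun n => Real.sqrt (-sn n) with hlam
  have hlam0 : ∀ n, 0 < lam n := fun n => Real.sqrt_pos.2 (neg_pos.2 (hsn0 n))
  have hlam2 : ∀ n, lam n ^ 2 = -sn n := fun n => Real.sq_sqrt (neg_pos.2 (hsn0 n)).le
  -- the zooms about `(0,0,z_n)` with factor `λ_n = √(−s_n)`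
  set w : ℕ → ℝ → EuclideanSpace ℝ (Fin 3) → EuclideanSpace ℝ (Fin 3) :=
    fun n => lam n • stPull (lam n ^ 2) (lam n) 0 (cylPt 0 0 (zn n)) v with hw
  have hwcl : ∀ n, IsTypeIAncientMild C (w n) := fun n => isTypeIAncientMild_zoom hA (hlam0 n) _
  have hwcirc : ∀ n r z s, circ (w n) r z s = circ v (lam n * r) (zn n + lam n * z) (lam n ^ 2 * s) := fun n r z s =>
    circ_zoom_axis (lam n) (zn n) v r z s
  have hwR₁ : ∀ n, circ (w n) R₁ 0 (-1) = circ v (R₁ * Real.sqrt (-sn n)) (zn n) (sn n) := by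
    intro n
    rw [hwcirc, mul_zero, add_zero, hlam2, mul_comm (lam n) R₁]
    congr 1
    ring
  have hwle1 : ∀ n, ∀ r : ℝ, 0 ≤ r → ∀ z, circ (w n) r z (-1) ≤ S₀ := by
    intro n r hr z
    rw [hwcirc, show lam n ^ 2 * (-1 : ℝ) = sn n by rw [hlam2]; ring]
    exact hleS _ (hp1 n) _ (mul_nonneg (hlam0 n).le hr) _
  have hwsign : ∀ n, SignE3 (w n) := by
    intro n σ hσ y
    have hcurl : curl (w n σ) y =
        (lam n * lam n) • curl (v (0 + lam n ^ 2 * σ)) (cylPt 0 0 (zn n) + lam n • y) :=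
      curl_smul_stPull (lam n) (lam n ^ 2) (lam n) 0 (cylPt 0 0 (zn n)) v σ y
    rw [hcurl, real_inner_smul_left]
    refine mul_nonneg (mul_self_nonneg _) (hsign _ ?_ _)
    rw [zero_add]; exact mul_neg_of_pos_of_neg (pow_pos (hlam0 n) 2) hσ
  -- compactness
  obtain ⟨φ, hφ, W, hW, hpt, hptG, hlu, hluG⟩ := exists_tendsto_of_isTypeIAncientMild_seq C hwcl
  have hWdoor : InDoorClass C W := inDoorClass_of_isTypeIAncientMild hW
  have hWsign : SignE3 W := by
    intro σ hσ y
    have hc : Tendsto (fun j => ⟪curl (w (φ j) σ) y, e3⟫) atTop (𝓝 ⟪curl (W σ) y, e3⟫) :=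
      (tendsto_curl_of_tendsto_fderiv (hptG σ hσ y)).inner tendsto_const_nhds
    exact ge_of_tendsto' hc fun j => hwsign (φ j) σ hσ y
  have hclim : ∀ σ < 0, ∀ r z, Tendsto (fun j => circ (w (φ j)) r z σ) atTop (𝓝 (circ W r z σ)) := fun σ hσ r z =>
    tendsto_circ (fun j => (hwcl (φ j)).continuous_slice hσ) (hW.continuous_slice hσ) (hlu σ hσ) r z
  -- the saturated disc of the limit
  have hWR₁ : circ W R₁ 0 (-1) = S₀ := by
    refine tendsto_nhds_unique (hclim (-1) hm1 R₁ 0) ?_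
    have hlow : Tendsto (fun j => S₀ - 1 / ((φ j : ℝ) + 1)) atTop (𝓝 S₀) := by
      have h1 : Tendsto (fun j => 1 / ((φ j : ℝ) + 1)) atTop (𝓝 0) := by
        have hφ' : Tendsto (fun j => ((φ j : ℕ) : ℝ)) atTop atTop :=
          tendsto_natCast_atTop_atTop.comp hφ.tendsto_atTop
        have : Tendsto (fun j => ((φ j : ℝ) + 1)) atTop atTop := tendsto_atTop_add_const_right _ 1 hφ'
        exact tendsto_const_nhds.div_atTop this
      simpa using tendsto_const_nhds.sub h1
    refine tendsto_of_tendsto_of_tendsto_of_le_of_le hlow tendsto_const_nhds (fun j => ?_) fun j => ?_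
    · rw [hwR₁]; exact (hp2 (φ j)).le
    · exact hwle1 (φ j) R₁ hR₁0 0
  have hWle : ∀ r : ℝ, 0 ≤ r → ∀ z, circ W r z (-1) ≤ S₀ := fun r hr z =>
    le_of_tendsto' (hclim (-1) hm1 r z) fun j => hwle1 (φ j) r hr z
  -- plane rigidity empties the saturated plane of the limit
  have h0 := circ_eq_zero_of_saturated_plane hWdoor hWsign hm1 hR₁0 hWR₁ (fun r hr => hWle r hr 0) R₁
  linarith

/-- **CENSUS READING (enemy form).**  A circulation-carrying closed-hemisphere door-class profile has, in EVERY far-past epoch `(−∞, σ₀]` and for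
all `B, R₀ ≥ 0`, a RECORD far circle `S(r,z)` at a time `t ≤ σ₀` (`r ≥ R₀√(−t)`; `Γ(r,z,t) > Γ(R₁√(−s'),z',s')` for all `s' ≤ t`, `z'`;
`R₁ = 4B + R₀ + 1`) through which vertical-vorticity flux ENTERS faster than `(B/√(−t))∮ω₃ dl`:  `−∮(v_rω₃ − ω_r v₃) dl > (B/√(−t))∮ω₃ dl`. -/
theorem enemy_record_fails (hv : InDoorClass C v) (hsign : SignE3 v) (hpos : ∃ σ < 0, ∃ y, 0 < ⟪curl (v σ) y, e3⟫)
    {B : ℝ} (hB : 0 ≤ B) {R₀ : ℝ} (hR₀ : 0 ≤ R₀) {σ₀ : ℝ} (hσ₀ : σ₀ < 0) :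
    ∃ t : ℝ, t ≤ σ₀ ∧ ∃ r : ℝ, R₀ * Real.sqrt (-t) ≤ r ∧ ∃ z : ℝ,
      (∀ s' : ℝ, s' ≤ t → ∀ z' : ℝ, circ v ((4 * B + R₀ + 1) * Real.sqrt (-s')) z' s' < circ v r z t) ∧
      B / Real.sqrt (-t) * vortCirc v r z t < -circleTerm v r z t := by
  by_contra h
  push Not at h
  obtain ⟨σ, hσ, y, hy⟩ := hpos
  have h0 := inner_curl_e3_eq_zero_of_recordTransportBound hv hsign hB hR₀ hσ₀
    (fun t ht r hr z hrec => h t ht r hr z hrec) σ hσ y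
  exact hy.ne' h0

/-- **Crux format.**  In the situation of the crux `CirculationCarryingRigidity` specialised to `e = e₃` (closed hemisphere, circulation-
carrying), the transport bound on the record circles of one far-past epoch is contradictory — in particular the apex is not backward-singular. -/
theorem not_isBackwardSingularPoint_of_recordTransportBound (hv : InDoorClass C v) (hsign : SignE3 v)
    (hpos : ∃ σ < 0, ∃ y, 0 < ⟪curl (v σ) y, e3⟫) {B : ℝ} (hB : 0 ≤ B) {R₀ : ℝ} (hR₀ : 0 ≤ R₀) {σ₀ : ℝ} (hσ₀ : σ₀ < 0)
    (htr : ∀ t : ℝ, t ≤ σ₀ → ∀ r : ℝ, R₀ * Real.sqrt (-t) ≤ r → ∀ z : ℝ,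
      (∀ s' : ℝ, s' ≤ t → ∀ z' : ℝ, circ v ((4 * B + R₀ + 1) * Real.sqrt (-s')) z' s' < circ v r z t) →
      -circleTerm v r z t ≤ B / Real.sqrt (-t) * vortCirc v r z t) :
    ¬ IsBackwardSingularPoint v 0 := by
  intro _
  obtain ⟨t, ht, r, hr, z, hrec, hlt⟩ := enemy_record_fails hv hsign hpos hB hR₀ hσ₀
  exact (not_lt.2 (htr t ht r hr z hrec)) hlt

/-- **BY-NAME REDUCTION of the open stub.**  If every closed-hemisphere profile of the door class obeys, for SOME `B, R₀ ≥ 0` and SOME epoch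
`σ₀ < 0`, the transport bound on the record circles about the `e₃`-axis at the times `≤ σ₀`, then `HemisphereLiouvilleE3` holds. -/
theorem hemisphereLiouvilleE3_of_recordTransportBound
    (H : ∀ (C : ℝ) (v : ℝ → EuclideanSpace ℝ (Fin 3) → EuclideanSpace ℝ (Fin 3)), InDoorClass C v → SignE3 v →
      ∃ B : ℝ, 0 ≤ B ∧ ∃ R₀ : ℝ, 0 ≤ R₀ ∧ ∃ σ₀ : ℝ, σ₀ < 0 ∧
        ∀ t : ℝ, t ≤ σ₀ → ∀ r : ℝ, R₀ * Real.sqrt (-t) ≤ r → ∀ z : ℝ,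
          (∀ s' : ℝ, s' ≤ t → ∀ z' : ℝ, circ v ((4 * B + R₀ + 1) * Real.sqrt (-s')) z' s' < circ v r z t) →
          -circleTerm v r z t ≤ B / Real.sqrt (-t) * vortCirc v r z t) :
    HemisphereLiouvilleE3 := by
  intro C v hrate hcont hmild hdiv hnn
  have hv : InDoorClass C v := ⟨hrate, hcont, hmild, hdiv⟩
  obtain ⟨B, hB, R₀, hR₀, σ₀, hσ₀, htr⟩ := H C v hv hnn
  exact inner_curl_e3_eq_zero_of_recordTransportBound hv hnn hB hR₀ hσ₀ htr

end Summit.NavierStokesRegularity.NavierStokesRegularity.Theorems.HalfSpaceWindowDoorCirculationCarryingRigidityRecordLiouville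

end
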